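import Summits.ResolutionOfSingularities.ResolutionOfSingularities.Theorems.MarkedTransferCampaignW46PlaneIsolated
import Mathlib.Logic.Function.Iterate
import HarnessLib

/-!
# [OURS · L1 W4.6 rung (i-a)] Infinite permissible sequences with isolated singular locus have a THREAD of
# infinitely near singular points that is blown up infinitely often (König for blow-up towers); the rung reduces
# to the absence of such threads
# (cell res-hironaka, LADDER-RESOLUTION rung L, D-0089; campaign s46, prover res-L1-s46-pv-1; host route
# MarkedTransfer, `--supports stmt-ResolutionOfSingularities-16155`)

HONEST FRAMING. Nothing here is a statement of H. Hironaka's manuscript (2017-03-23, [Hironaka2017]). Pure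
combinatorics (a König-type lemma for towers of finite sets whose maps are injective off one «centre» per level)
and its instantiation to the résumé-free permissible sequences of this campaign (`CampaignW46.PermissibleRun`,
regime `Regime.isolatedSing` of `MarkedTransferCampaignW46PlaneIsolated`). The only geometric inputs are tree
theorems already used by the companion modules: a blow-up along a closed point is injective off that point
(`IsBlowup.isIso_compl`) and singular points of the transform lie over singular points
(`CampaignW46.sing_subset_of_transform`). AI review is weaker than expert review. No `sorry`; axioms standard.

## Why (the second route to rung (i-a), any dimension)

`MarkedTransferCampaignW46PlaneIsolated` reduces the rung to a UNIFORM local exit bound. This file gives the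
NON-UNIFORM alternative: in a regime with isolated singular locus an infinite permissible sequence blows up, at each
stage, one closed point `x_k ∈ Sing(E_k)`; the sets `Sing(E_k)` are finite, map to each other under the blow-ups
(`π_k(Sing(E_{k+1})) ⊆ Sing(E_k)`), and `π_k` is injective on `Sing(E_{k+1})` away from the fibre of `x_k`. A
counting argument (every stage contributes one centre; centres descend to the finitely many points of `Sing(E_0)`)
produces a compatible thread `y_k ∈ Sing(E_k)`, `π_k(y_{k+1}) = y_k`, with `y_k = x_k` for INFINITELY MANY `k`
(`PermissibleRun.nonempty_hitThread`). Hence `PermissiblyTerminates Rg` follows from «no run in `Rg` carries such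
a thread» (`permissiblyTerminates_of_noHitThread`): the remaining work for rung (i-a) along this route is a LOCAL
statement about one chain of infinitely near points of a surface (the local rings along the thread change only at
the hit stages, by quadratic transformations), recorded as `PlaneIsolatedNoHitThread`.

## Contents

* `Tower.par`, `Tower.anc`, `Tower.DC`, `Tower.exists_root`, `Tower.exists_child`, **`Tower.exists_hitThread`** —
  the abstract König lemma: types `X k`, maps `f k : X (k+1) → X k`, finite sets `S k ∋ c k` with `f k (S (k+1)) ⊆
  S k` and `f k` injective on `S (k+1)` off the fibre of `c k` ⟹ a thread in the `S k`, compatible with the `f k`,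
  meeting the centres `c k` infinitely often.
* `injOn_sing_of_step` — injectivity of a point blow-up off the centre, on the singular locus.
* `PermissibleRun.HitThread`, **`PermissibleRun.nonempty_hitThread`** (regime `isolatedSing`, any dimension),
  `NoHitThread Rg`, **`permissiblyTerminates_of_noHitThread`**, `PlaneIsolatedNoHitThread`,
  `planeIsolatedPermissiblyTerminates_of_noHitThread`.

## References

* D. Kőnig's infinity lemma (finitely branching infinite trees), here in an ad-hoc form for towers. [folklore]
* companion modules `MarkedTransferCampaignW46PermissibleReduction`, `MarkedTransferCampaignW46PlaneIsolated` (this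
  seat); H. Hironaka, ms. 2017-03-23, Th. 16.13 p.87 l.26–28 — scope only, under adjudication. [Hironaka2017]
-/

noncomputable section

set_option linter.dupNamespace false -- mandated namespace of this single-conjunct summit

open CategoryTheory AlgebraicGeometry TopologicalSpace

namespace Summit.ResolutionOfSingularities.ResolutionOfSingularities.Theorems

namespace CampaignW46

universe u

/-! ## König for towers whose maps are injective off one centre per level -/

namespace Tower

variable {X : ℕ → Type u} (f : ∀ k, X (k + 1) → X k)

/-- The nodes of a tower of types `X k`: pairs (level, point). [folklore] -/
abbrev Node (X : ℕ → Type u) := Σ k, X k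

/-- The parent of a node under the maps `f k : X (k+1) → X k` (level-`0` nodes are their own parents). [folklore] -/
def par : Node X → Node X
  | ⟨0, z⟩ => ⟨0, z⟩
  | ⟨k + 1, z⟩ => ⟨k, f k z⟩

/-- The `j`-fold ancestor. [folklore] -/
def anc (j : ℕ) : Node X → Node X := (par f)^[j]

/-- The parent lowers the level by one. [folklore] -/
theorem par_fst (n : Node X) : (par f n).1 = n.1 - 1 := by
  obtain ⟨k, z⟩ := n
  cases k <;> rfl

/-- The `j`-fold ancestor lowers the level by `j`. [folklore] -/
theorem anc_fst (j : ℕ) (n : Node X) : (anc f j n).1 = n.1 - j := by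
  induction j with
  | zero => rfl
  | succ j ih =>
    rw [anc, Function.iterate_succ_apply', par_fst, ← anc, ih]
    omega

/-- Unfolding one ancestor step. [folklore] -/
theorem anc_succ (j : ℕ) (n : Node X) : anc f (j + 1) n = par f (anc f j n) := by
  rw [anc, Function.iterate_succ_apply']
  rfl

variable {S : ∀ k, Set (X k)} (hf : ∀ k (y : X (k + 1)), y ∈ S (k + 1) → f k y ∈ S k)

include hf in
/-- Parents of nodes in `S` are in `S`. [folklore] -/
theorem par_mem (n : Node X) (hn : n.2 ∈ S n.1) : (par f n).2 ∈ S (par f n).1 := by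
  obtain ⟨k, z⟩ := n
  cases k with
  | zero => exact hn
  | succ k => exact hf k z hn

include hf in
/-- Ancestors of nodes in `S` are in `S`. [folklore] -/
theorem anc_mem (j : ℕ) (n : Node X) (hn : n.2 ∈ S n.1) : (anc f j n).2 ∈ S (anc f j n).1 := by
  induction j with
  | zero => exact hn
  | succ j ih => rw [anc_succ]; exact par_mem f hf _ ih

/-- The stages `m ≥ level(n)` whose centre `c m` lies over the node `n`. [folklore] -/
def DC (c : ∀ k, X k) (n : Node X) : Set ℕ :=
  {m | n.1 ≤ m ∧ anc f (m - n.1) ⟨m, c m⟩ = n}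

variable (c : ∀ k, X k)

/-- The nodes of a given level with point in `S` form a finite set. [folklore] -/
theorem finite_level (hS : ∀ k, (S k).Finite) (k : ℕ) :
    {n : Node X | n.1 = k ∧ n.2 ∈ S n.1}.Finite := by
  refine ((hS k).image fun z : X k => (⟨k, z⟩ : Node X)).subset ?_
  rintro ⟨k', z⟩ ⟨hk, hz⟩
  dsimp only at hk
  subst hk
  exact ⟨z, hz, rfl⟩

include hf in
/-- A root with infinitely many centres over it (pigeonhole over `S 0`). [folklore] -/
theorem exists_root (hS : ∀ k, (S k).Finite) (hc : ∀ k, c k ∈ S k) :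
    ∃ z : X 0, z ∈ S 0 ∧ (DC f c ⟨0, z⟩).Infinite := by
  classical
  let T := {n : Node X | n.1 = 0 ∧ n.2 ∈ S n.1}
  have hT : T.Finite := finite_level hS 0
  haveI := hT.to_subtype
  have hg : ∀ m, anc f m ⟨m, c m⟩ ∈ T := fun m =>
    ⟨by rw [anc_fst]; simp, anc_mem f hf m ⟨m, c m⟩ (hc m)⟩
  let g : ℕ → T := fun m => ⟨anc f m ⟨m, c m⟩, hg m⟩
  obtain ⟨⟨n, hn⟩, hinf⟩ := Finite.exists_infinite_fiber g
  obtain ⟨k, z⟩ := n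
  obtain ⟨hk, hz⟩ := id hn
  dsimp only at hk
  subst hk
  refine ⟨z, hz, ?_⟩
  have hsub : (g ⁻¹' {⟨⟨0, z⟩, hn⟩} : Set ℕ) ⊆ DC f c ⟨0, z⟩ := by
    intro m hm
    refine ⟨Nat.zero_le m, ?_⟩
    have := congrArg Subtype.val (show g m = ⟨⟨0, z⟩, hn⟩ from hm)
    simpa using this
  exact (Set.infinite_coe_iff.mp hinf).mono hsub

include hf in
/-- A node with infinitely many centres over it has a child with the same property (pigeonhole over the finite
fibre). [folklore] -/
theorem exists_child (hS : ∀ k, (S k).Finite) (hc : ∀ k, c k ∈ S k) {k : ℕ} {z : X k}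
    (hinf : (DC f c ⟨k, z⟩).Infinite) :
    ∃ z' : X (k + 1), z' ∈ S (k + 1) ∧ f k z' = z ∧ (DC f c ⟨k + 1, z'⟩).Infinite := by
  classical
  -- stages strictly above `k`
  have hD' : (DC f c ⟨k, z⟩ ∩ {m | k + 1 ≤ m}).Infinite := by
    have : DC f c ⟨k, z⟩ ⊆ (DC f c ⟨k, z⟩ ∩ {m | k + 1 ≤ m}) ∪ {k} := by
      intro m hm
      by_cases h : k + 1 ≤ m
      · exact Or.inl ⟨hm, h⟩
      · have : m = k := by have := hm.1; dsimp only at this; omega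
        exact Or.inr this
    exact ((hinf.mono this).sdiff (Set.finite_singleton k)).mono fun m hm => by
      rcases hm with ⟨hm, hne⟩
      rcases hm with hm | hm
      · exact hm
      · exact absurd hm hne
  let T := {n : Node X | n.1 = k + 1 ∧ n.2 ∈ S n.1}
  have hT : T.Finite := finite_level hS (k + 1)
  haveI := hT.to_subtype
  haveI := hD'.to_subtype
  have hg : ∀ m : ↥(DC f c ⟨k, z⟩ ∩ {m | k + 1 ≤ m}), anc f (m.1 - (k + 1)) ⟨m.1, c m.1⟩ ∈ T := fun m =>
    ⟨by rw [anc_fst]; dsimp only; have := m.2.2; simp only [Set.mem_setOf_eq] at this; omega,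
      anc_mem f hf _ ⟨m.1, c m.1⟩ (hc m.1)⟩
  let g : ↥(DC f c ⟨k, z⟩ ∩ {m | k + 1 ≤ m}) → T := fun m => ⟨_, hg m⟩
  obtain ⟨⟨n, hn⟩, hfib⟩ := Finite.exists_infinite_fiber g
  obtain ⟨k', z'⟩ := n
  obtain ⟨hk', hz'⟩ := id hn
  dsimp only at hk'
  subst hk'
  -- every `m` in the fibre: `anc (m - (k+1)) ⟨m, c m⟩ = ⟨k+1, z'⟩`, and its parent is `⟨k, z⟩`
  have key : ∀ m : ↥(DC f c ⟨k, z⟩ ∩ {m | k + 1 ≤ m}), g m = ⟨⟨k + 1, z'⟩, hn⟩ →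
      anc f (m.1 - (k + 1)) ⟨m.1, c m.1⟩ = ⟨k + 1, z'⟩ ∧ f k z' = z := by
    intro m hm
    have h1 : anc f (m.1 - (k + 1)) ⟨m.1, c m.1⟩ = ⟨k + 1, z'⟩ := by
      have := congrArg Subtype.val hm
      simpa using this
    refine ⟨h1, ?_⟩
    have h2 : anc f (m.1 - k) ⟨m.1, c m.1⟩ = ⟨k, z⟩ := by
      have := m.2.1.2; simpa using this
    have h3 : m.1 - k = m.1 - (k + 1) + 1 := by
      have := m.2.2; simp only [Set.mem_setOf_eq] at this; omega
    rw [h3, anc_succ, h1] at h2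
    -- `par ⟨k+1, z'⟩ = ⟨k, f k z'⟩`
    have h4 : par f ⟨k + 1, z'⟩ = ⟨k, f k z'⟩ := rfl
    rw [h4] at h2
    exact eq_of_heq (Sigma.mk.inj_iff.mp h2).2
  obtain ⟨m₀, hm₀⟩ : ∃ m, m ∈ (g ⁻¹' {⟨⟨k + 1, z'⟩, hn⟩}) := by
    have := (Set.infinite_coe_iff.mp hfib).nonempty
    exact this
  refine ⟨z', hz', (key m₀ hm₀).2, ?_⟩
  -- the fibre injects into `DC ⟨k+1, z'⟩`
  have hsub : Subtype.val '' (g ⁻¹' {⟨⟨k + 1, z'⟩, hn⟩}) ⊆ DC f c ⟨k + 1, z'⟩ := by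
    rintro _ ⟨m, hm, rfl⟩
    refine ⟨?_, (key m hm).1⟩
    have := m.2.2; simp only [Set.mem_setOf_eq] at this; exact this
  refine Set.Infinite.mono hsub ?_
  exact (Set.infinite_coe_iff.mp hfib).image Subtype.val_injective.injOn


include hf in
/-- **König for towers with injective-off-centre maps.** Types `X k`, maps `f k : X (k+1) → X k`, finite sets
`S k` containing the centres `c k`, with `f k (S (k+1)) ⊆ S k` and `f k` injective on `S (k+1)` away from the
fibre of `c k`: there is a thread `y k ∈ S k` with `f k (y (k+1)) = y k` passing through the centres infinitely
often. (Branch through nodes with infinitely many centres above them; if such a branch avoided the centres from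
level `k₀` on, injectivity would force every centre above `y k₀` onto the branch.) [folklore] -/
theorem exists_hitThread (hS : ∀ k, (S k).Finite) (hc : ∀ k, c k ∈ S k)
    (hinj : ∀ k (y y' : X (k + 1)), y ∈ S (k + 1) → y' ∈ S (k + 1) → f k y = f k y' → f k y ≠ c k → y = y') :
    ∃ y : ∀ k, X k, (∀ k, y k ∈ S k) ∧ (∀ k, f k (y (k + 1)) = y k) ∧ ∀ k₀, ∃ k, k₀ ≤ k ∧ y k = c k := by
  classical
  -- the branch: nodes with infinitely many centres above them
  have hroot := exists_root f hf c hS hc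
  let P : ∀ k, X k → Prop := fun k z => z ∈ S k ∧ (DC f c ⟨k, z⟩).Infinite
  have hstep : ∀ k (z : X k), P k z → ∃ z' : X (k + 1), P (k + 1) z' ∧ f k z' = z := by
    rintro k z ⟨-, hz⟩
    obtain ⟨z', hz'S, hfz', hinf'⟩ := exists_child f hf c hS hc hz
    exact ⟨z', ⟨hz'S, hinf'⟩, hfz'⟩
  let br : ∀ k, {z : X k // P k z} := fun k =>
    Nat.rec (motive := fun k => {z : X k // P k z})
      ⟨Classical.choose hroot, Classical.choose_spec hroot⟩
      (fun k zk => ⟨Classical.choose (hstep k zk.1 zk.2), (Classical.choose_spec (hstep k zk.1 zk.2)).1⟩) k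
  have hbr : ∀ k, f k (br (k + 1)).1 = (br k).1 := fun k =>
    (Classical.choose_spec (hstep k (br k).1 (br k).2)).2
  refine ⟨fun k => (br k).1, fun k => (br k).2.1, hbr, ?_⟩
  -- hit infinitely often
  intro k₀
  by_contra! hno
  obtain ⟨m, hm⟩ := (br k₀).2.2.nonempty
  obtain ⟨hkm, hanc⟩ := hm
  dsimp only at hkm hanc
  -- climb from level `k₀` to level `m` along the branch
  have climb : ∀ j, k₀ ≤ j → j ≤ m → anc f (m - j) ⟨m, c m⟩ = ⟨j, (br j).1⟩ := by
    intro j hj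
    induction j, hj using Nat.le_induction with
    | base => intro _; exact hanc
    | succ j hj ih =>
      intro hjm
      have hprev := ih (by omega)
      have hsplit : m - j = m - (j + 1) + 1 := by omega
      rw [hsplit, anc_succ] at hprev
      -- the node at level `j+1`
      have hlev : (anc f (m - (j + 1)) ⟨m, c m⟩).1 = j + 1 := by rw [anc_fst]; dsimp only; omega
      have hmemS : (anc f (m - (j + 1)) ⟨m, c m⟩).2 ∈ S (anc f (m - (j + 1)) ⟨m, c m⟩).1 :=
        anc_mem f hf _ _ (hc m)
      revert hprev hlev hmemS
      generalize anc f (m - (j + 1)) ⟨m, c m⟩ = n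
      intro hprev hlev hmemS
      obtain ⟨j', z'⟩ := n
      dsimp only at hlev
      subst hlev
      have hpar : par f ⟨j + 1, z'⟩ = ⟨j, f j z'⟩ := rfl
      rw [hpar] at hprev
      have hfz' : f j z' = (br j).1 := eq_of_heq (Sigma.mk.inj_iff.mp hprev).2
      have hne : f j z' ≠ c j := by rw [hfz']; exact hno j hj
      have := hinj j z' (br (j + 1)).1 hmemS (br (j + 1)).2.1 (hfz'.trans (hbr j).symm) hne
      rw [this]
  have htop := climb m hkm le_rfl
  rw [Nat.sub_self] at htop
  have : c m = (br m).1 := eq_of_heq (Sigma.mk.inj_iff.mp htop).2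
  exact hno m hkm this.symm


end Tower

/-! ## Threads of a permissible sequence -/

open Literature.AlgebraicGeometry.Resolution
open Literature.AlgebraicGeometry.Hironaka2017.S02Preliminaries
open Scheme.IdealSheafData

variable {p : ℕ} [Fact p.Prime] {K : Type u} [Field K] [CharP K p]

/-- A blow-up along the reduced ideal of a closed point `x` is injective off the fibre of `x` (it is an
isomorphism, in particular an open embedding, over the complement). [cite: StacksProject, Tag 02OS] -/
theorem injOn_of_isBlowup_point {Z Z' : Scheme.{u}} {π : Z' ⟶ Z} {D : Closeds Z}
    (hπ : IsBlowup π (vanishingIdeal D)) {y y' : Z'} (h : π y = π y') (hy : π y ∉ (D : Set Z)) :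
    y = y' := by
  set W₀ : Z.Opens := ⟨((vanishingIdeal D).support : Set Z)ᶜ, (vanishingIdeal D).support.isClosed.isOpen_compl⟩
  haveI : IsIso (π ∣_ W₀) := hπ.isIso_compl
  have hW : (W₀ : Set Z) = (D : Set Z)ᶜ := by
    show ((vanishingIdeal D).support : Set Z)ᶜ = _
    rw [coe_support_vanishingIdeal]
  have hyW : y ∈ π ⁻¹ᵁ W₀ := show π y ∈ (W₀ : Set Z) by rw [hW]; exact hy
  have hy'W : y' ∈ π ⁻¹ᵁ W₀ := show π y' ∈ (W₀ : Set Z) by rw [hW, ← h]; exact hy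
  have heq : (π ∣_ W₀) ⟨y, hyW⟩ = (π ∣_ W₀) ⟨y', hy'W⟩ := by
    apply Subtype.ext
    rw [morphismRestrict_base_coe, morphismRestrict_base_coe]
    exact h
  exact congrArg Subtype.val ((π ∣_ W₀).isOpenEmbedding.injective heq)

namespace PermissibleRun

variable (r : PermissibleRun p K)

/-- [OURS · L1 W4.6 rung (i-a)] NOT a statement of the manuscript. A HIT THREAD of an infinite permissible sequence:
singular points `y k ∈ Sing(E k)`, compatible under the blow-ups, such that the centre of stage `k` is `{y k}` for
infinitely many `k` (a chain of infinitely near singular points that is blown up infinitely often). [folklore] -/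
structure HitThread where
  /-- the point of the thread at stage `k` -/
  y : ∀ k, (r.A k).Z
  /-- it is singular -/
  mem : ∀ k, y k ∈ (r.E k).sing
  /-- compatibility with the blow-ups -/
  compat : ∀ k, r.π k (y (k + 1)) = y k
  /-- blown up infinitely often -/
  hit : ∀ k₀, ∃ k, k₀ ≤ k ∧ (r.D k : Set (r.A k).Z) = {y k}

/-- **Thread extraction.** [OURS · L1 W4.6 rung (i-a)] NOT a statement of the manuscript. An infinite permissible
sequence all of whose stages have isolated singular locus (`Regime.isolatedSing`: `Sing` finite and closed-pointed;
any dimension) carries a hit thread. [folklore] -/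
theorem nonempty_hitThread (hr : ∀ k, Regime.isolatedSing (r.A k) (r.E k)) : Nonempty r.HitThread := by
  classical
  -- the centres are closed points `x k ∈ Sing(E k)` with `D k = {x k}`
  have hx : ∀ k, ∃ ξ : (r.A k).Z, ξ ∈ (r.E k).sing ∧ IsClosed ({ξ} : Set (r.A k).Z) ∧
      (r.D k : Set (r.A k).Z) = {ξ} :=
    fun k => IsPermissibleCentre.exists_eq_singleton_of_isolatedSing (r.permissible k) (hr k)
  choose x hxS _ hDx using hx
  -- the tower
  have hf : ∀ k (y : (r.A (k + 1)).Z), y ∈ (r.E (k + 1)).sing → r.π k y ∈ (r.E k).sing := by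
    intro k y hy
    haveI : IsLocallyNoetherian (r.A (k + 1)).Z := ambient_isLocallyNoetherian _
    rw [r.E_succ k] at hy
    exact sing_subset_of_transform (r.blowup k) (r.E k) (r.permissible k).subset_sing hy
  have hinj : ∀ k (y y' : (r.A (k + 1)).Z), y ∈ (r.E (k + 1)).sing → y' ∈ (r.E (k + 1)).sing →
      r.π k y = r.π k y' → r.π k y ≠ x k → y = y' := by
    intro k y y' _ _ h hne
    refine injOn_of_isBlowup_point (r.blowup k) h ?_
    rw [hDx]; exact hne
  obtain ⟨y, hyS, hcompat, hhit⟩ :=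
    Tower.exists_hitThread (X := fun k => ↥(r.A k).Z) (fun k => (r.π k).base) (S := fun k => (r.E k).sing) hf x
      (fun k => (hr k).1) hxS hinj
  refine ⟨⟨y, hyS, hcompat, fun k₀ => ?_⟩⟩
  obtain ⟨k, hk, hyk⟩ := hhit k₀
  exact ⟨k, hk, by rw [hDx, hyk]⟩

end PermissibleRun

/-- [OURS · L1 W4.6 rung (i-a)] NOT a statement of the manuscript. «NO HIT THREAD in the regime `Rg`»: no infinite
permissible sequence inside `Rg` carries a chain of infinitely near singular points blown up infinitely often — the
LOCAL form of termination (one chain of local rings, changing by quadratic transformations at the hit stages).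
[folklore] -/
def NoHitThread (Rg : Regime p K) : Prop :=
  ∀ r : PermissibleRun p K, (∀ k, Rg (r.A k) (r.E k)) → r.HitThread → False

/-- **The rung from the local form (any dimension).** [OURS · L1 W4.6] NOT a statement of the manuscript. In a regime
with isolated singular locus, «no hit thread» implies «no infinite permissible sequence». [folklore] -/
theorem permissiblyTerminates_of_noHitThread {Rg : Regime p K}
    (hRg : ∀ (A : AmbientDatum p K) (E : IdealExponent A.Z), Rg A E → Regime.isolatedSing A E)
    (h : NoHitThread Rg) : PermissiblyTerminates Rg := fun r hr =>
  (r.nonempty_hitThread fun k => hRg _ _ (hr k)).elim (h r hr)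

/-- [OURS · L1 W4.6 rung (i-a)] NOT a statement of the manuscript. The local form of rung (i-a): no hit thread on
surfaces with isolated singular locus. [folklore] -/
def PlaneIsolatedNoHitThread (p : ℕ) [Fact p.Prime] (K : Type u) [Field K] [CharP K p] : Prop :=
  NoHitThread (regimePlaneIsolated (p := p) (K := K))

/-- **Rung (i-a) from its local (thread) form.** [folklore] -/
theorem planeIsolatedPermissiblyTerminates_of_noHitThread (h : PlaneIsolatedNoHitThread p K) :
    PlaneIsolatedPermissiblyTerminates p K :=
  permissiblyTerminates_of_noHitThread (fun _ _ hRg => hRg.2) h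

end CampaignW46

end Summit.ResolutionOfSingularities.ResolutionOfSingularities.Theorems

end
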